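import Mathlib
import HarnessLib
import Summits.ValiantsHypothesis.ValiantsHypothesis.Theorems.LacunarySymmetroidMatrixDescartesOsculationCensusRankOneLower
import Summits.ValiantsHypothesis.ValiantsHypothesis.Theorems.LacunarySymmetroidMatrixDescartesOsculationCensusExtremisersThree

/-!
# ValiantsHypothesis / LacunarySymmetroid — crux `MatrixDescartes` (stmt-ValiantsHypothesis-18050, V1),
# line «osculation-law» (`Cruxes/MatrixDescartes/Lines/osculation_law.lean`), rung O3: LOWER-SIDE instances — the F4 pencil's rank-one osculation sets are non-empty

Roster R2664 (b) / R2685 (O3 = val-sym-engine-7); critic val-idea-crit-1 VERDICT #76 («the O3 CONTENT is the LOWER side»).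
Companion of `…OsculationCensusExtremisersLower` (ν(2,5): `4 ≤ ncard ≤ 36`) and `…ExtremisersLowerSmall` (ν(2,3): `2 ≤ ncard ≤ 18`).

CONTENT.  `osc_card_ge_F4_top0 / _top1 / _top2`: the F4 extremal pencil (`ν(3,3) = 7`, `fullyRealisable_three_013_seven`) at its
three rank-one splittings — `1 ≤ ncard` (located-exact `1` each; with the landed `osc_card_le_F4_top*` of `…ExtremisersThree`:
`1 ≤ ncard ≤ 22 / 22 / 26`, i.e. every F4 rank-one osculation set is NON-EMPTY and finite).  Route: `osc_rankOne_card_ge` (`…RankOneLower`) with per-window lemmas (monomial bounds for the sign of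
`det G · det G₂₂` on `[l,u]`, exact dyadic evaluations of `R = W(det G)(det G₂₂)² − W(det G₂₂)(det G)²` at the end-points); finiteness
from the landed F4 instances (`osc_card_le_F4_top*`).  Windows certified by exact rational arithmetic (val-sym-engine-7 g3).

CALIBRATION, NOT LAW.  `m = 2, 3` are covered by `rungTwo` / `rungThree`; the LAW `stub_osculationLaw`, the crux `MatrixDescartes`,
Conjecture B and `VP ≠ VNP` are OPEN / NOT proved; no summit statement is proved by this file.  No definitions, no named facts.
-/

-- `Summit.ValiantsHypothesis.ValiantsHypothesis.…` is the tree's mandated single-conjunct layout (Sub = Summit).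
set_option linter.dupNamespace false

noncomputable section

namespace Summit.ValiantsHypothesis.ValiantsHypothesis.Theorems.LacunarySymmetroidMatrixDescartes

open Polynomial Matrix Finset
open scoped BigOperators

namespace OsculationCensus
/-- Window 0 (F4t0), `[17937/16384, 71749/65536]`: branch in the open quadrant (`F·A < 0` by monomial bounds) and a sign
change of the reduced eliminant `R` (exact dyadic evaluations). [folklore] -/
theorem F4t0_window_0 (F A : ℝ[X])
    (hF : F = ((C (20 : ℝ) + C ((-7) : ℝ) * X + C ((-8) : ℝ) * X ^ 3) * (C (10 : ℝ) + C ((-63) : ℝ) * X + C ((-8) : ℝ) * X ^ 3) * (C ((-182) : ℝ) + C (8 : ℝ) * X)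
        - (C (20 : ℝ) + C ((-7) : ℝ) * X + C ((-8) : ℝ) * X ^ 3) * (C ((-169) : ℝ) + C (53 : ℝ) * X) * (C ((-169) : ℝ) + C (53 : ℝ) * X)
        - (C ((-17) : ℝ) + C (12 : ℝ) * X) * (C ((-17) : ℝ) + C (12 : ℝ) * X) * (C ((-182) : ℝ) + C (8 : ℝ) * X)
        + (C ((-17) : ℝ) + C (12 : ℝ) * X) * (C ((-169) : ℝ) + C (53 : ℝ) * X) * (C (101 : ℝ) + C ((-95) : ℝ) * X)
        + (C (101 : ℝ) + C ((-95) : ℝ) * X) * (C ((-17) : ℝ) + C (12 : ℝ) * X) * (C ((-169) : ℝ) + C (53 : ℝ) * X)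
        - (C (101 : ℝ) + C ((-95) : ℝ) * X) * (C (10 : ℝ) + C ((-63) : ℝ) * X + C ((-8) : ℝ) * X ^ 3) * (C (101 : ℝ) + C ((-95) : ℝ) * X)))
    (hA : A = ((C (10 : ℝ) + C ((-63) : ℝ) * X + C ((-8) : ℝ) * X ^ 3) * (C ((-182) : ℝ) + C (8 : ℝ) * X)
        - (C ((-169) : ℝ) + C (53 : ℝ) * X) * (C ((-169) : ℝ) + C (53 : ℝ) * X))) :
    (0 : ℝ) < 17937/16384 ∧ ((17937/16384 : ℝ) ≤ 71749/65536) ∧ (∀ x : ℝ, (17937/16384 : ℝ) ≤ x → x ≤ (71749/65536 : ℝ) → F.eval x * A.eval x < 0) ∧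
    (((F * (X * derivative (X * derivative F)) - (X * derivative F) ^ 2) * A ^ 2
      - (A * (X * derivative (X * derivative A)) - (X * derivative A) ^ 2) * F ^ 2)).eval (17937/16384 : ℝ) *
    (((F * (X * derivative (X * derivative F)) - (X * derivative F) ^ 2) * A ^ 2
      - (A * (X * derivative (X * derivative A)) - (X * derivative A) ^ 2) * F ^ 2)).eval (71749/65536 : ℝ) ≤ 0 := by
  refine ⟨by norm_num, by norm_num, ?_, ?_⟩
  · intro x hlx hxu
    have hx0 : (0:ℝ) ≤ x := by linarith
    have bl2 := pow_le_pow_left₀ (by norm_num : (0:ℝ) ≤ 17937/16384) hlx 2; have bu2 := pow_le_pow_left₀ hx0 hxu 2; norm_num at bl2 bu2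
    have bl3 := pow_le_pow_left₀ (by norm_num : (0:ℝ) ≤ 17937/16384) hlx 3; have bu3 := pow_le_pow_left₀ hx0 hxu 3; norm_num at bl3 bu3
    have bl4 := pow_le_pow_left₀ (by norm_num : (0:ℝ) ≤ 17937/16384) hlx 4; have bu4 := pow_le_pow_left₀ hx0 hxu 4; norm_num at bl4 bu4
    have bl5 := pow_le_pow_left₀ (by norm_num : (0:ℝ) ≤ 17937/16384) hlx 5; have bu5 := pow_le_pow_left₀ hx0 hxu 5; norm_num at bl5 bu5
    have bl6 := pow_le_pow_left₀ (by norm_num : (0:ℝ) ≤ 17937/16384) hlx 6; have bu6 := pow_le_pow_left₀ hx0 hxu 6; norm_num at bl6 bu6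
    have bl7 := pow_le_pow_left₀ (by norm_num : (0:ℝ) ≤ 17937/16384) hlx 7; have bu7 := pow_le_pow_left₀ hx0 hxu 7; norm_num at bl7 bu7
    have eF : F.eval x =
        (((-76686) : ℝ) + (422334 : ℝ) * x + ((-857246) : ℝ) * x ^ 2 + (823550 : ℝ) * x ^ 3 + ((-400672) : ℝ) * x ^ 4
          + (99152 : ℝ) * x ^ 5 + ((-11648) : ℝ) * x ^ 6 + (512 : ℝ) * x ^ 7) := by
      rw [hF]; simp only [eval_add, eval_sub, eval_mul, eval_pow, eval_C, eval_X]; ring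
    have eA : A.eval x =
        (((-30381) : ℝ) + (29460 : ℝ) * x + ((-3313) : ℝ) * x ^ 2 + (1456 : ℝ) * x ^ 3 + ((-64) : ℝ) * x ^ 4) := by
      rw [hA]; simp only [eval_add, eval_sub, eval_mul, eval_pow, eval_C, eval_X]; ring
    have hFx : 0 < F.eval x := by rw [eF]; linarith
    have hAx : A.eval x < 0 := by rw [eA]; linarith
    exact mul_neg_of_pos_of_neg hFx hAx
  · have rl : (((F * (X * derivative (X * derivative F)) - (X * derivative F) ^ 2) * A ^ 2
      - (A * (X * derivative (X * derivative A)) - (X * derivative A) ^ 2) * F ^ 2)).eval (17937/16384 : ℝ) < 0 := by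
      subst hF hA
      simp only [eval_sub, eval_mul, eval_pow, eval_add, eval_C, eval_X,
      derivative_add, derivative_sub, derivative_mul, derivative_C, derivative_X, derivative_X_pow, zero_mul, zero_add,
      one_mul, mul_one]
      norm_num
    have ru : 0 < (((F * (X * derivative (X * derivative F)) - (X * derivative F) ^ 2) * A ^ 2
      - (A * (X * derivative (X * derivative A)) - (X * derivative A) ^ 2) * F ^ 2)).eval (71749/65536 : ℝ) := by
      subst hF hA
      simp only [eval_sub, eval_mul, eval_pow, eval_add, eval_C, eval_X,
      derivative_add, derivative_sub, derivative_mul, derivative_C, derivative_X, derivative_X_pow, zero_mul, zero_add,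
      one_mul, mul_one]
      norm_num
    exact le_of_lt (mul_neg_of_neg_of_pos rl ru)

/-- **O3 lower instance (F4, coordinate `0` on top):** at least ONE osculation point (located-exact count `1`; with
`osc_card_le_F4_top0`: `1 ≤ ncard ≤ 22`). [folklore] -/
theorem osc_card_ge_F4_top0 (S : Fin 3 → Matrix (Fin 1 ⊕ Fin 2) (Fin 1 ⊕ Fin 2) ℝ)
    (hS : S = ![Matrix.fromBlocks !![(20 : ℝ)] !![-17, 101] !![-17; 101] !![10, -169; -169, -182],
        Matrix.fromBlocks !![(-7 : ℝ)] !![12, -95] !![12; -95] !![-63, 53; 53, 8],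
        Matrix.fromBlocks !![(-8 : ℝ)] !![0, 0] !![0; 0] !![-8, 0; 0, 0]]) :
    1 ≤
    {p : Fin 2 → ℝ | 0 < p 0 ∧ 0 < p 1 ∧ MvPolynomial.eval p (∑ l, (MvPolynomial.X (0 : Fin 2) : MvPolynomial (Fin 2) ℝ) ^ (![0, 1, 3] : Fin 3 → ℕ) l • (S l).map (MvPolynomial.C : ℝ →+*
      MvPolynomial (Fin 2) ℝ) + (MvPolynomial.X (1 : Fin 2) : MvPolynomial (Fin 2) ℝ) • (Matrix.fromBlocks 1 0 0 0 : Matrix (Fin 1 ⊕ Fin 2) (Fin 1 ⊕ Fin 2) ℝ).map (MvPolynomial.C : ℝ →+*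
      MvPolynomial (Fin 2) ℝ)).det = 0 ∧ MvPolynomial.eval p (MvPolynomial.X 0 * MvPolynomial.pderiv 0 (MvPolynomial.X 0 * MvPolynomial.pderiv 0 (∑ l, (MvPolynomial.X (0 : Fin 2) :
      MvPolynomial (Fin 2) ℝ) ^ (![0, 1, 3] : Fin 3 → ℕ) l • (S l).map (MvPolynomial.C : ℝ →+* MvPolynomial (Fin 2) ℝ) + (MvPolynomial.X (1 : Fin 2) : MvPolynomial (Fin 2) ℝ) •
      (Matrix.fromBlocks 1 0 0 0 : Matrix (Fin 1 ⊕ Fin 2) (Fin 1 ⊕ Fin 2) ℝ).map (MvPolynomial.C : ℝ →+* MvPolynomial (Fin 2) ℝ)).det) * (MvPolynomial.X 1 * MvPolynomial.pderiv 1 (∑ l,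
      (MvPolynomial.X (0 : Fin 2) : MvPolynomial (Fin 2) ℝ) ^ (![0, 1, 3] : Fin 3 → ℕ) l • (S l).map (MvPolynomial.C : ℝ →+* MvPolynomial (Fin 2) ℝ) + (MvPolynomial.X (1 : Fin 2) :
      MvPolynomial (Fin 2) ℝ) • (Matrix.fromBlocks 1 0 0 0 : Matrix (Fin 1 ⊕ Fin 2) (Fin 1 ⊕ Fin 2) ℝ).map (MvPolynomial.C : ℝ →+* MvPolynomial (Fin 2) ℝ)).det) ^ 2 - 2 * (MvPolynomial.X 0 *
      MvPolynomial.pderiv 0 (MvPolynomial.X 1 * MvPolynomial.pderiv 1 (∑ l, (MvPolynomial.X (0 : Fin 2) : MvPolynomial (Fin 2) ℝ) ^ (![0, 1, 3] : Fin 3 → ℕ) l • (S l).map (MvPolynomial.C : ℝ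
      →+* MvPolynomial (Fin 2) ℝ) + (MvPolynomial.X (1 : Fin 2) : MvPolynomial (Fin 2) ℝ) • (Matrix.fromBlocks 1 0 0 0 : Matrix (Fin 1 ⊕ Fin 2) (Fin 1 ⊕ Fin 2) ℝ).map (MvPolynomial.C : ℝ →+*
      MvPolynomial (Fin 2) ℝ)).det)) * (MvPolynomial.X 0 * MvPolynomial.pderiv 0 (∑ l, (MvPolynomial.X (0 : Fin 2) : MvPolynomial (Fin 2) ℝ) ^ (![0, 1, 3] : Fin 3 → ℕ) l • (S l).map
      (MvPolynomial.C : ℝ →+* MvPolynomial (Fin 2) ℝ) + (MvPolynomial.X (1 : Fin 2) : MvPolynomial (Fin 2) ℝ) • (Matrix.fromBlocks 1 0 0 0 : Matrix (Fin 1 ⊕ Fin 2) (Fin 1 ⊕ Fin 2) ℝ).map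
      (MvPolynomial.C : ℝ →+* MvPolynomial (Fin 2) ℝ)).det) * (MvPolynomial.X 1 * MvPolynomial.pderiv 1 (∑ l, (MvPolynomial.X (0 : Fin 2) : MvPolynomial (Fin 2) ℝ) ^ (![0, 1, 3] : Fin 3 → ℕ)
      l • (S l).map (MvPolynomial.C : ℝ →+* MvPolynomial (Fin 2) ℝ) + (MvPolynomial.X (1 : Fin 2) : MvPolynomial (Fin 2) ℝ) • (Matrix.fromBlocks 1 0 0 0 : Matrix (Fin 1 ⊕ Fin 2) (Fin 1 ⊕ Fin
      2) ℝ).map (MvPolynomial.C : ℝ →+* MvPolynomial (Fin 2) ℝ)).det) + MvPolynomial.X 1 * MvPolynomial.pderiv 1 (MvPolynomial.X 1 * MvPolynomial.pderiv 1 (∑ l, (MvPolynomial.X (0 : Fin 2) :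
      MvPolynomial (Fin 2) ℝ) ^ (![0, 1, 3] : Fin 3 → ℕ) l • (S l).map (MvPolynomial.C : ℝ →+* MvPolynomial (Fin 2) ℝ) + (MvPolynomial.X (1 : Fin 2) : MvPolynomial (Fin 2) ℝ) •
      (Matrix.fromBlocks 1 0 0 0 : Matrix (Fin 1 ⊕ Fin 2) (Fin 1 ⊕ Fin 2) ℝ).map (MvPolynomial.C : ℝ →+* MvPolynomial (Fin 2) ℝ)).det) * (MvPolynomial.X 0 * MvPolynomial.pderiv 0 (∑ l,
      (MvPolynomial.X (0 : Fin 2) : MvPolynomial (Fin 2) ℝ) ^ (![0, 1, 3] : Fin 3 → ℕ) l • (S l).map (MvPolynomial.C : ℝ →+* MvPolynomial (Fin 2) ℝ) + (MvPolynomial.X (1 : Fin 2) :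
      MvPolynomial (Fin 2) ℝ) • (Matrix.fromBlocks 1 0 0 0 : Matrix (Fin 1 ⊕ Fin 2) (Fin 1 ⊕ Fin 2) ℝ).map (MvPolynomial.C : ℝ →+* MvPolynomial (Fin 2) ℝ)).det) ^ 2) = 0}.ncard := by
  have hfin := (osc_card_le_F4_top0 S hS).1
  subst hS
  have hF : (∑ l, (X : ℝ[X]) ^ (![0, 1, 3] : Fin 3 → ℕ) l • ((![Matrix.fromBlocks !![(20 : ℝ)] !![-17, 101] !![-17; 101] !![10, -169; -169, -182],
        Matrix.fromBlocks !![(-7 : ℝ)] !![12, -95] !![12; -95] !![-63, 53; 53, 8],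
        Matrix.fromBlocks !![(-8 : ℝ)] !![0, 0] !![0; 0] !![-8, 0; 0, 0]] : Fin 3 → Matrix (Fin 1 ⊕ Fin 2) (Fin 1 ⊕ Fin 2) ℝ) l).map Polynomial.C).det =
      ((C (20 : ℝ) + C ((-7) : ℝ) * X + C ((-8) : ℝ) * X ^ 3) * (C (10 : ℝ) + C ((-63) : ℝ) * X + C ((-8) : ℝ) * X ^ 3) * (C ((-182) : ℝ) + C (8 : ℝ) * X)
        - (C (20 : ℝ) + C ((-7) : ℝ) * X + C ((-8) : ℝ) * X ^ 3) * (C ((-169) : ℝ) + C (53 : ℝ) * X) * (C ((-169) : ℝ) + C (53 : ℝ) * X)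
        - (C ((-17) : ℝ) + C (12 : ℝ) * X) * (C ((-17) : ℝ) + C (12 : ℝ) * X) * (C ((-182) : ℝ) + C (8 : ℝ) * X)
        + (C ((-17) : ℝ) + C (12 : ℝ) * X) * (C ((-169) : ℝ) + C (53 : ℝ) * X) * (C (101 : ℝ) + C ((-95) : ℝ) * X)
        + (C (101 : ℝ) + C ((-95) : ℝ) * X) * (C ((-17) : ℝ) + C (12 : ℝ) * X) * (C ((-169) : ℝ) + C (53 : ℝ) * X)
        - (C (101 : ℝ) + C ((-95) : ℝ) * X) * (C (10 : ℝ) + C ((-63) : ℝ) * X + C ((-8) : ℝ) * X ^ 3) * (C (101 : ℝ) + C ((-95) : ℝ) * X)) := by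
    rw [det_pencil_one_two]; simp [Fin.sum_univ_succ, -mul_eq_mul_right_iff, -mul_eq_mul_left_iff]; ring
  have hA : (∑ l, (X : ℝ[X]) ^ (![0, 1, 3] : Fin 3 → ℕ) l • (((![Matrix.fromBlocks !![(20 : ℝ)] !![-17, 101] !![-17; 101] !![10, -169; -169, -182],
        Matrix.fromBlocks !![(-7 : ℝ)] !![12, -95] !![12; -95] !![-63, 53; 53, 8],
        Matrix.fromBlocks !![(-8 : ℝ)] !![0, 0] !![0; 0] !![-8, 0; 0, 0]] : Fin 3 → Matrix (Fin 1 ⊕ Fin 2) (Fin 1 ⊕ Fin 2) ℝ) l).toBlocks₂₂).map Polynomial.C).det =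
      ((C (10 : ℝ) + C ((-63) : ℝ) * X + C ((-8) : ℝ) * X ^ 3) * (C ((-182) : ℝ) + C (8 : ℝ) * X)
        - (C ((-169) : ℝ) + C (53 : ℝ) * X) * (C ((-169) : ℝ) + C (53 : ℝ) * X)) := by
    rw [det_lower_two]; simp [Fin.sum_univ_succ, -mul_eq_mul_right_iff, -mul_eq_mul_left_iff]; ring
  refine osc_rankOne_card_ge (![0, 1, 3] : Fin 3 → ℕ) _ _ _ hF hA hfin [((17937/16384 : ℝ), (71749/65536 : ℝ))]
    (by simp) ?_
  intro w hw
  simp only [List.mem_cons, List.not_mem_nil, or_false] at hw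
  subst hw
  exact F4t0_window_0 _ _ rfl rfl

/-- Window 0 (F4t1), `[9173/8192, 18347/16384]`: branch in the open quadrant (`F·A < 0` by monomial bounds) and a sign
change of the reduced eliminant `R` (exact dyadic evaluations). [folklore] -/
theorem F4t1_window_0 (F A : ℝ[X])
    (hF : F = ((C (10 : ℝ) + C ((-63) : ℝ) * X + C ((-8) : ℝ) * X ^ 3) * (C (20 : ℝ) + C ((-7) : ℝ) * X + C ((-8) : ℝ) * X ^ 3) * (C ((-182) : ℝ) + C (8 : ℝ) * X)
        - (C (10 : ℝ) + C ((-63) : ℝ) * X + C ((-8) : ℝ) * X ^ 3) * (C (101 : ℝ) + C ((-95) : ℝ) * X) * (C (101 : ℝ) + C ((-95) : ℝ) * X)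
        - (C ((-17) : ℝ) + C (12 : ℝ) * X) * (C ((-17) : ℝ) + C (12 : ℝ) * X) * (C ((-182) : ℝ) + C (8 : ℝ) * X)
        + (C ((-17) : ℝ) + C (12 : ℝ) * X) * (C (101 : ℝ) + C ((-95) : ℝ) * X) * (C ((-169) : ℝ) + C (53 : ℝ) * X)
        + (C ((-169) : ℝ) + C (53 : ℝ) * X) * (C ((-17) : ℝ) + C (12 : ℝ) * X) * (C (101 : ℝ) + C ((-95) : ℝ) * X)
        - (C ((-169) : ℝ) + C (53 : ℝ) * X) * (C (20 : ℝ) + C ((-7) : ℝ) * X + C ((-8) : ℝ) * X ^ 3) * (C ((-169) : ℝ) + C (53 : ℝ) * X)))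
    (hA : A = ((C (20 : ℝ) + C ((-7) : ℝ) * X + C ((-8) : ℝ) * X ^ 3) * (C ((-182) : ℝ) + C (8 : ℝ) * X)
        - (C (101 : ℝ) + C ((-95) : ℝ) * X) * (C (101 : ℝ) + C ((-95) : ℝ) * X))) :
    (0 : ℝ) < 9173/8192 ∧ ((9173/8192 : ℝ) ≤ 18347/16384) ∧ (∀ x : ℝ, (9173/8192 : ℝ) ≤ x → x ≤ (18347/16384 : ℝ) → F.eval x * A.eval x < 0) ∧
    (((F * (X * derivative (X * derivative F)) - (X * derivative F) ^ 2) * A ^ 2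
      - (A * (X * derivative (X * derivative A)) - (X * derivative A) ^ 2) * F ^ 2)).eval (9173/8192 : ℝ) *
    (((F * (X * derivative (X * derivative F)) - (X * derivative F) ^ 2) * A ^ 2
      - (A * (X * derivative (X * derivative A)) - (X * derivative A) ^ 2) * F ^ 2)).eval (18347/16384 : ℝ) ≤ 0 := by
  refine ⟨by norm_num, by norm_num, ?_, ?_⟩
  · intro x hlx hxu
    have hx0 : (0:ℝ) ≤ x := by linarith
    have bl2 := pow_le_pow_left₀ (by norm_num : (0:ℝ) ≤ 9173/8192) hlx 2; have bu2 := pow_le_pow_left₀ hx0 hxu 2; norm_num at bl2 bu2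
    have bl3 := pow_le_pow_left₀ (by norm_num : (0:ℝ) ≤ 9173/8192) hlx 3; have bu3 := pow_le_pow_left₀ hx0 hxu 3; norm_num at bl3 bu3
    have bl4 := pow_le_pow_left₀ (by norm_num : (0:ℝ) ≤ 9173/8192) hlx 4; have bu4 := pow_le_pow_left₀ hx0 hxu 4; norm_num at bl4 bu4
    have bl5 := pow_le_pow_left₀ (by norm_num : (0:ℝ) ≤ 9173/8192) hlx 5; have bu5 := pow_le_pow_left₀ hx0 hxu 5; norm_num at bl5 bu5
    have bl6 := pow_le_pow_left₀ (by norm_num : (0:ℝ) ≤ 9173/8192) hlx 6; have bu6 := pow_le_pow_left₀ hx0 hxu 6; norm_num at bl6 bu6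
    have bl7 := pow_le_pow_left₀ (by norm_num : (0:ℝ) ≤ 9173/8192) hlx 7; have bu7 := pow_le_pow_left₀ hx0 hxu 7; norm_num at bl7 bu7
    have eF : F.eval x =
        (((-76686) : ℝ) + (422334 : ℝ) * x + ((-857246) : ℝ) * x ^ 2 + (823550 : ℝ) * x ^ 3 + ((-400672) : ℝ) * x ^ 4
          + (99152 : ℝ) * x ^ 5 + ((-11648) : ℝ) * x ^ 6 + (512 : ℝ) * x ^ 7) := by
      rw [hF]; simp only [eval_add, eval_sub, eval_mul, eval_pow, eval_C, eval_X]; ring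
    have eA : A.eval x =
        (((-13841) : ℝ) + (20624 : ℝ) * x + ((-9081) : ℝ) * x ^ 2 + (1456 : ℝ) * x ^ 3 + ((-64) : ℝ) * x ^ 4) := by
      rw [hA]; simp only [eval_add, eval_sub, eval_mul, eval_pow, eval_C, eval_X]; ring
    have hFx : 0 < F.eval x := by rw [eF]; linarith
    have hAx : A.eval x < 0 := by rw [eA]; linarith
    exact mul_neg_of_pos_of_neg hFx hAx
  · have rl : (((F * (X * derivative (X * derivative F)) - (X * derivative F) ^ 2) * A ^ 2
      - (A * (X * derivative (X * derivative A)) - (X * derivative A) ^ 2) * F ^ 2)).eval (9173/8192 : ℝ) < 0 := by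
      subst hF hA
      simp only [eval_sub, eval_mul, eval_pow, eval_add, eval_C, eval_X,
      derivative_add, derivative_sub, derivative_mul, derivative_C, derivative_X, derivative_X_pow, zero_mul, zero_add,
      one_mul, mul_one]
      norm_num
    have ru : 0 < (((F * (X * derivative (X * derivative F)) - (X * derivative F) ^ 2) * A ^ 2
      - (A * (X * derivative (X * derivative A)) - (X * derivative A) ^ 2) * F ^ 2)).eval (18347/16384 : ℝ) := by
      subst hF hA
      simp only [eval_sub, eval_mul, eval_pow, eval_add, eval_C, eval_X,
      derivative_add, derivative_sub, derivative_mul, derivative_C, derivative_X, derivative_X_pow, zero_mul, zero_add,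
      one_mul, mul_one]
      norm_num
    exact le_of_lt (mul_neg_of_neg_of_pos rl ru)

/-- **O3 lower instance (F4, coordinate `1` on top):** at least ONE osculation point (located-exact count `1`; with
`osc_card_le_F4_top1`: `1 ≤ ncard ≤ 22`). [folklore] -/
theorem osc_card_ge_F4_top1 (S : Fin 3 → Matrix (Fin 1 ⊕ Fin 2) (Fin 1 ⊕ Fin 2) ℝ)
    (hS : S = ![Matrix.fromBlocks !![(10 : ℝ)] !![-17, -169] !![-17; -169] !![20, 101; 101, -182],
        Matrix.fromBlocks !![(-63 : ℝ)] !![12, 53] !![12; 53] !![-7, -95; -95, 8],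
        Matrix.fromBlocks !![(-8 : ℝ)] !![0, 0] !![0; 0] !![-8, 0; 0, 0]]) :
    1 ≤
    {p : Fin 2 → ℝ | 0 < p 0 ∧ 0 < p 1 ∧ MvPolynomial.eval p (∑ l, (MvPolynomial.X (0 : Fin 2) : MvPolynomial (Fin 2) ℝ) ^ (![0, 1, 3] : Fin 3 → ℕ) l • (S l).map (MvPolynomial.C : ℝ →+*
      MvPolynomial (Fin 2) ℝ) + (MvPolynomial.X (1 : Fin 2) : MvPolynomial (Fin 2) ℝ) • (Matrix.fromBlocks 1 0 0 0 : Matrix (Fin 1 ⊕ Fin 2) (Fin 1 ⊕ Fin 2) ℝ).map (MvPolynomial.C : ℝ →+*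
      MvPolynomial (Fin 2) ℝ)).det = 0 ∧ MvPolynomial.eval p (MvPolynomial.X 0 * MvPolynomial.pderiv 0 (MvPolynomial.X 0 * MvPolynomial.pderiv 0 (∑ l, (MvPolynomial.X (0 : Fin 2) :
      MvPolynomial (Fin 2) ℝ) ^ (![0, 1, 3] : Fin 3 → ℕ) l • (S l).map (MvPolynomial.C : ℝ →+* MvPolynomial (Fin 2) ℝ) + (MvPolynomial.X (1 : Fin 2) : MvPolynomial (Fin 2) ℝ) •
      (Matrix.fromBlocks 1 0 0 0 : Matrix (Fin 1 ⊕ Fin 2) (Fin 1 ⊕ Fin 2) ℝ).map (MvPolynomial.C : ℝ →+* MvPolynomial (Fin 2) ℝ)).det) * (MvPolynomial.X 1 * MvPolynomial.pderiv 1 (∑ l,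
      (MvPolynomial.X (0 : Fin 2) : MvPolynomial (Fin 2) ℝ) ^ (![0, 1, 3] : Fin 3 → ℕ) l • (S l).map (MvPolynomial.C : ℝ →+* MvPolynomial (Fin 2) ℝ) + (MvPolynomial.X (1 : Fin 2) :
      MvPolynomial (Fin 2) ℝ) • (Matrix.fromBlocks 1 0 0 0 : Matrix (Fin 1 ⊕ Fin 2) (Fin 1 ⊕ Fin 2) ℝ).map (MvPolynomial.C : ℝ →+* MvPolynomial (Fin 2) ℝ)).det) ^ 2 - 2 * (MvPolynomial.X 0 *
      MvPolynomial.pderiv 0 (MvPolynomial.X 1 * MvPolynomial.pderiv 1 (∑ l, (MvPolynomial.X (0 : Fin 2) : MvPolynomial (Fin 2) ℝ) ^ (![0, 1, 3] : Fin 3 → ℕ) l • (S l).map (MvPolynomial.C : ℝ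
      →+* MvPolynomial (Fin 2) ℝ) + (MvPolynomial.X (1 : Fin 2) : MvPolynomial (Fin 2) ℝ) • (Matrix.fromBlocks 1 0 0 0 : Matrix (Fin 1 ⊕ Fin 2) (Fin 1 ⊕ Fin 2) ℝ).map (MvPolynomial.C : ℝ →+*
      MvPolynomial (Fin 2) ℝ)).det)) * (MvPolynomial.X 0 * MvPolynomial.pderiv 0 (∑ l, (MvPolynomial.X (0 : Fin 2) : MvPolynomial (Fin 2) ℝ) ^ (![0, 1, 3] : Fin 3 → ℕ) l • (S l).map
      (MvPolynomial.C : ℝ →+* MvPolynomial (Fin 2) ℝ) + (MvPolynomial.X (1 : Fin 2) : MvPolynomial (Fin 2) ℝ) • (Matrix.fromBlocks 1 0 0 0 : Matrix (Fin 1 ⊕ Fin 2) (Fin 1 ⊕ Fin 2) ℝ).map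
      (MvPolynomial.C : ℝ →+* MvPolynomial (Fin 2) ℝ)).det) * (MvPolynomial.X 1 * MvPolynomial.pderiv 1 (∑ l, (MvPolynomial.X (0 : Fin 2) : MvPolynomial (Fin 2) ℝ) ^ (![0, 1, 3] : Fin 3 → ℕ)
      l • (S l).map (MvPolynomial.C : ℝ →+* MvPolynomial (Fin 2) ℝ) + (MvPolynomial.X (1 : Fin 2) : MvPolynomial (Fin 2) ℝ) • (Matrix.fromBlocks 1 0 0 0 : Matrix (Fin 1 ⊕ Fin 2) (Fin 1 ⊕ Fin
      2) ℝ).map (MvPolynomial.C : ℝ →+* MvPolynomial (Fin 2) ℝ)).det) + MvPolynomial.X 1 * MvPolynomial.pderiv 1 (MvPolynomial.X 1 * MvPolynomial.pderiv 1 (∑ l, (MvPolynomial.X (0 : Fin 2) :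
      MvPolynomial (Fin 2) ℝ) ^ (![0, 1, 3] : Fin 3 → ℕ) l • (S l).map (MvPolynomial.C : ℝ →+* MvPolynomial (Fin 2) ℝ) + (MvPolynomial.X (1 : Fin 2) : MvPolynomial (Fin 2) ℝ) •
      (Matrix.fromBlocks 1 0 0 0 : Matrix (Fin 1 ⊕ Fin 2) (Fin 1 ⊕ Fin 2) ℝ).map (MvPolynomial.C : ℝ →+* MvPolynomial (Fin 2) ℝ)).det) * (MvPolynomial.X 0 * MvPolynomial.pderiv 0 (∑ l,
      (MvPolynomial.X (0 : Fin 2) : MvPolynomial (Fin 2) ℝ) ^ (![0, 1, 3] : Fin 3 → ℕ) l • (S l).map (MvPolynomial.C : ℝ →+* MvPolynomial (Fin 2) ℝ) + (MvPolynomial.X (1 : Fin 2) :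
      MvPolynomial (Fin 2) ℝ) • (Matrix.fromBlocks 1 0 0 0 : Matrix (Fin 1 ⊕ Fin 2) (Fin 1 ⊕ Fin 2) ℝ).map (MvPolynomial.C : ℝ →+* MvPolynomial (Fin 2) ℝ)).det) ^ 2) = 0}.ncard := by
  have hfin := (osc_card_le_F4_top1 S hS).1
  subst hS
  have hF : (∑ l, (X : ℝ[X]) ^ (![0, 1, 3] : Fin 3 → ℕ) l • ((![Matrix.fromBlocks !![(10 : ℝ)] !![-17, -169] !![-17; -169] !![20, 101; 101, -182],
        Matrix.fromBlocks !![(-63 : ℝ)] !![12, 53] !![12; 53] !![-7, -95; -95, 8],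
        Matrix.fromBlocks !![(-8 : ℝ)] !![0, 0] !![0; 0] !![-8, 0; 0, 0]] : Fin 3 → Matrix (Fin 1 ⊕ Fin 2) (Fin 1 ⊕ Fin 2) ℝ) l).map Polynomial.C).det =
      ((C (10 : ℝ) + C ((-63) : ℝ) * X + C ((-8) : ℝ) * X ^ 3) * (C (20 : ℝ) + C ((-7) : ℝ) * X + C ((-8) : ℝ) * X ^ 3) * (C ((-182) : ℝ) + C (8 : ℝ) * X)
        - (C (10 : ℝ) + C ((-63) : ℝ) * X + C ((-8) : ℝ) * X ^ 3) * (C (101 : ℝ) + C ((-95) : ℝ) * X) * (C (101 : ℝ) + C ((-95) : ℝ) * X)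
        - (C ((-17) : ℝ) + C (12 : ℝ) * X) * (C ((-17) : ℝ) + C (12 : ℝ) * X) * (C ((-182) : ℝ) + C (8 : ℝ) * X)
        + (C ((-17) : ℝ) + C (12 : ℝ) * X) * (C (101 : ℝ) + C ((-95) : ℝ) * X) * (C ((-169) : ℝ) + C (53 : ℝ) * X)
        + (C ((-169) : ℝ) + C (53 : ℝ) * X) * (C ((-17) : ℝ) + C (12 : ℝ) * X) * (C (101 : ℝ) + C ((-95) : ℝ) * X)
        - (C ((-169) : ℝ) + C (53 : ℝ) * X) * (C (20 : ℝ) + C ((-7) : ℝ) * X + C ((-8) : ℝ) * X ^ 3) * (C ((-169) : ℝ) + C (53 : ℝ) * X)) := by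
    rw [det_pencil_one_two]; simp [Fin.sum_univ_succ, -mul_eq_mul_right_iff, -mul_eq_mul_left_iff]; ring
  have hA : (∑ l, (X : ℝ[X]) ^ (![0, 1, 3] : Fin 3 → ℕ) l • (((![Matrix.fromBlocks !![(10 : ℝ)] !![-17, -169] !![-17; -169] !![20, 101; 101, -182],
        Matrix.fromBlocks !![(-63 : ℝ)] !![12, 53] !![12; 53] !![-7, -95; -95, 8],
        Matrix.fromBlocks !![(-8 : ℝ)] !![0, 0] !![0; 0] !![-8, 0; 0, 0]] : Fin 3 → Matrix (Fin 1 ⊕ Fin 2) (Fin 1 ⊕ Fin 2) ℝ) l).toBlocks₂₂).map Polynomial.C).det =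
      ((C (20 : ℝ) + C ((-7) : ℝ) * X + C ((-8) : ℝ) * X ^ 3) * (C ((-182) : ℝ) + C (8 : ℝ) * X)
        - (C (101 : ℝ) + C ((-95) : ℝ) * X) * (C (101 : ℝ) + C ((-95) : ℝ) * X)) := by
    rw [det_lower_two]; simp [Fin.sum_univ_succ, -mul_eq_mul_right_iff, -mul_eq_mul_left_iff]; ring
  refine osc_rankOne_card_ge (![0, 1, 3] : Fin 3 → ℕ) _ _ _ hF hA hfin [((9173/8192 : ℝ), (18347/16384 : ℝ))]
    (by simp) ?_
  intro w hw
  simp only [List.mem_cons, List.not_mem_nil, or_false] at hw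
  subst hw
  exact F4t1_window_0 _ _ rfl rfl

/-- Window 0 (F4t2), `[9141/8192, 18283/16384]`: branch in the open quadrant (`F·A < 0` by monomial bounds) and a sign
change of the reduced eliminant `R` (exact dyadic evaluations). [folklore] -/
theorem F4t2_window_0 (F A : ℝ[X])
    (hF : F = ((C ((-182) : ℝ) + C (8 : ℝ) * X) * (C (20 : ℝ) + C ((-7) : ℝ) * X + C ((-8) : ℝ) * X ^ 3) * (C (10 : ℝ) + C ((-63) : ℝ) * X + C ((-8) : ℝ) * X ^ 3)
        - (C ((-182) : ℝ) + C (8 : ℝ) * X) * (C ((-17) : ℝ) + C (12 : ℝ) * X) * (C ((-17) : ℝ) + C (12 : ℝ) * X)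
        - (C (101 : ℝ) + C ((-95) : ℝ) * X) * (C (101 : ℝ) + C ((-95) : ℝ) * X) * (C (10 : ℝ) + C ((-63) : ℝ) * X + C ((-8) : ℝ) * X ^ 3)
        + (C (101 : ℝ) + C ((-95) : ℝ) * X) * (C ((-17) : ℝ) + C (12 : ℝ) * X) * (C ((-169) : ℝ) + C (53 : ℝ) * X)
        + (C ((-169) : ℝ) + C (53 : ℝ) * X) * (C (101 : ℝ) + C ((-95) : ℝ) * X) * (C ((-17) : ℝ) + C (12 : ℝ) * X)
        - (C ((-169) : ℝ) + C (53 : ℝ) * X) * (C (20 : ℝ) + C ((-7) : ℝ) * X + C ((-8) : ℝ) * X ^ 3) * (C ((-169) : ℝ) + C (53 : ℝ) * X)))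
    (hA : A = ((C (20 : ℝ) + C ((-7) : ℝ) * X + C ((-8) : ℝ) * X ^ 3) * (C (10 : ℝ) + C ((-63) : ℝ) * X + C ((-8) : ℝ) * X ^ 3)
        - (C ((-17) : ℝ) + C (12 : ℝ) * X) * (C ((-17) : ℝ) + C (12 : ℝ) * X))) :
    (0 : ℝ) < 9141/8192 ∧ ((9141/8192 : ℝ) ≤ 18283/16384) ∧ (∀ x : ℝ, (9141/8192 : ℝ) ≤ x → x ≤ (18283/16384 : ℝ) → F.eval x * A.eval x < 0) ∧
    (((F * (X * derivative (X * derivative F)) - (X * derivative F) ^ 2) * A ^ 2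
      - (A * (X * derivative (X * derivative A)) - (X * derivative A) ^ 2) * F ^ 2)).eval (9141/8192 : ℝ) *
    (((F * (X * derivative (X * derivative F)) - (X * derivative F) ^ 2) * A ^ 2
      - (A * (X * derivative (X * derivative A)) - (X * derivative A) ^ 2) * F ^ 2)).eval (18283/16384 : ℝ) ≤ 0 := by
  refine ⟨by norm_num, by norm_num, ?_, ?_⟩
  · intro x hlx hxu
    have hx0 : (0:ℝ) ≤ x := by linarith
    have bl2 := pow_le_pow_left₀ (by norm_num : (0:ℝ) ≤ 9141/8192) hlx 2; have bu2 := pow_le_pow_left₀ hx0 hxu 2; norm_num at bl2 bu2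
    have bl3 := pow_le_pow_left₀ (by norm_num : (0:ℝ) ≤ 9141/8192) hlx 3; have bu3 := pow_le_pow_left₀ hx0 hxu 3; norm_num at bl3 bu3
    have bl4 := pow_le_pow_left₀ (by norm_num : (0:ℝ) ≤ 9141/8192) hlx 4; have bu4 := pow_le_pow_left₀ hx0 hxu 4; norm_num at bl4 bu4
    have bl5 := pow_le_pow_left₀ (by norm_num : (0:ℝ) ≤ 9141/8192) hlx 5; have bu5 := pow_le_pow_left₀ hx0 hxu 5; norm_num at bl5 bu5
    have bl6 := pow_le_pow_left₀ (by norm_num : (0:ℝ) ≤ 9141/8192) hlx 6; have bu6 := pow_le_pow_left₀ hx0 hxu 6; norm_num at bl6 bu6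
    have bl7 := pow_le_pow_left₀ (by norm_num : (0:ℝ) ≤ 9141/8192) hlx 7; have bu7 := pow_le_pow_left₀ hx0 hxu 7; norm_num at bl7 bu7
    have eF : F.eval x =
        (((-76686) : ℝ) + (422334 : ℝ) * x + ((-857246) : ℝ) * x ^ 2 + (823550 : ℝ) * x ^ 3 + ((-400672) : ℝ) * x ^ 4
          + (99152 : ℝ) * x ^ 5 + ((-11648) : ℝ) * x ^ 6 + (512 : ℝ) * x ^ 7) := by
      rw [hF]; simp only [eval_add, eval_sub, eval_mul, eval_pow, eval_C, eval_X]; ring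
    have eA : A.eval x =
        (((-89) : ℝ) + ((-922) : ℝ) * x + (297 : ℝ) * x ^ 2 + ((-240) : ℝ) * x ^ 3 + (560 : ℝ) * x ^ 4 + (64 : ℝ) * x ^ 6) := by
      rw [hA]; simp only [eval_add, eval_sub, eval_mul, eval_pow, eval_C, eval_X]; ring
    have hFx : 0 < F.eval x := by rw [eF]; linarith
    have hAx : A.eval x < 0 := by rw [eA]; linarith
    exact mul_neg_of_pos_of_neg hFx hAx
  · have rl : (((F * (X * derivative (X * derivative F)) - (X * derivative F) ^ 2) * A ^ 2
      - (A * (X * derivative (X * derivative A)) - (X * derivative A) ^ 2) * F ^ 2)).eval (9141/8192 : ℝ) < 0 := by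
      subst hF hA
      simp only [eval_sub, eval_mul, eval_pow, eval_add, eval_C, eval_X,
      derivative_add, derivative_sub, derivative_mul, derivative_C, derivative_X, derivative_X_pow, zero_mul, zero_add,
      one_mul, mul_one]
      norm_num
    have ru : 0 < (((F * (X * derivative (X * derivative F)) - (X * derivative F) ^ 2) * A ^ 2
      - (A * (X * derivative (X * derivative A)) - (X * derivative A) ^ 2) * F ^ 2)).eval (18283/16384 : ℝ) := by
      subst hF hA
      simp only [eval_sub, eval_mul, eval_pow, eval_add, eval_C, eval_X,
      derivative_add, derivative_sub, derivative_mul, derivative_C, derivative_X, derivative_X_pow, zero_mul, zero_add,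
      one_mul, mul_one]
      norm_num
    exact le_of_lt (mul_neg_of_neg_of_pos rl ru)

/-- **O3 lower instance (F4, coordinate `2` on top):** at least ONE osculation point (located-exact count `1`; with
`osc_card_le_F4_top2`: `1 ≤ ncard ≤ 26`). [folklore] -/
theorem osc_card_ge_F4_top2 (S : Fin 3 → Matrix (Fin 1 ⊕ Fin 2) (Fin 1 ⊕ Fin 2) ℝ)
    (hS : S = ![Matrix.fromBlocks !![(-182 : ℝ)] !![101, -169] !![101; -169] !![20, -17; -17, 10],
        Matrix.fromBlocks !![(8 : ℝ)] !![-95, 53] !![-95; 53] !![-7, 12; 12, -63],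
        Matrix.fromBlocks !![(0 : ℝ)] !![0, 0] !![0; 0] !![-8, 0; 0, -8]]) :
    1 ≤
    {p : Fin 2 → ℝ | 0 < p 0 ∧ 0 < p 1 ∧ MvPolynomial.eval p (∑ l, (MvPolynomial.X (0 : Fin 2) : MvPolynomial (Fin 2) ℝ) ^ (![0, 1, 3] : Fin 3 → ℕ) l • (S l).map (MvPolynomial.C : ℝ →+*
      MvPolynomial (Fin 2) ℝ) + (MvPolynomial.X (1 : Fin 2) : MvPolynomial (Fin 2) ℝ) • (Matrix.fromBlocks 1 0 0 0 : Matrix (Fin 1 ⊕ Fin 2) (Fin 1 ⊕ Fin 2) ℝ).map (MvPolynomial.C : ℝ →+*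
      MvPolynomial (Fin 2) ℝ)).det = 0 ∧ MvPolynomial.eval p (MvPolynomial.X 0 * MvPolynomial.pderiv 0 (MvPolynomial.X 0 * MvPolynomial.pderiv 0 (∑ l, (MvPolynomial.X (0 : Fin 2) :
      MvPolynomial (Fin 2) ℝ) ^ (![0, 1, 3] : Fin 3 → ℕ) l • (S l).map (MvPolynomial.C : ℝ →+* MvPolynomial (Fin 2) ℝ) + (MvPolynomial.X (1 : Fin 2) : MvPolynomial (Fin 2) ℝ) •
      (Matrix.fromBlocks 1 0 0 0 : Matrix (Fin 1 ⊕ Fin 2) (Fin 1 ⊕ Fin 2) ℝ).map (MvPolynomial.C : ℝ →+* MvPolynomial (Fin 2) ℝ)).det) * (MvPolynomial.X 1 * MvPolynomial.pderiv 1 (∑ l,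
      (MvPolynomial.X (0 : Fin 2) : MvPolynomial (Fin 2) ℝ) ^ (![0, 1, 3] : Fin 3 → ℕ) l • (S l).map (MvPolynomial.C : ℝ →+* MvPolynomial (Fin 2) ℝ) + (MvPolynomial.X (1 : Fin 2) :
      MvPolynomial (Fin 2) ℝ) • (Matrix.fromBlocks 1 0 0 0 : Matrix (Fin 1 ⊕ Fin 2) (Fin 1 ⊕ Fin 2) ℝ).map (MvPolynomial.C : ℝ →+* MvPolynomial (Fin 2) ℝ)).det) ^ 2 - 2 * (MvPolynomial.X 0 *
      MvPolynomial.pderiv 0 (MvPolynomial.X 1 * MvPolynomial.pderiv 1 (∑ l, (MvPolynomial.X (0 : Fin 2) : MvPolynomial (Fin 2) ℝ) ^ (![0, 1, 3] : Fin 3 → ℕ) l • (S l).map (MvPolynomial.C : ℝ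
      →+* MvPolynomial (Fin 2) ℝ) + (MvPolynomial.X (1 : Fin 2) : MvPolynomial (Fin 2) ℝ) • (Matrix.fromBlocks 1 0 0 0 : Matrix (Fin 1 ⊕ Fin 2) (Fin 1 ⊕ Fin 2) ℝ).map (MvPolynomial.C : ℝ →+*
      MvPolynomial (Fin 2) ℝ)).det)) * (MvPolynomial.X 0 * MvPolynomial.pderiv 0 (∑ l, (MvPolynomial.X (0 : Fin 2) : MvPolynomial (Fin 2) ℝ) ^ (![0, 1, 3] : Fin 3 → ℕ) l • (S l).map
      (MvPolynomial.C : ℝ →+* MvPolynomial (Fin 2) ℝ) + (MvPolynomial.X (1 : Fin 2) : MvPolynomial (Fin 2) ℝ) • (Matrix.fromBlocks 1 0 0 0 : Matrix (Fin 1 ⊕ Fin 2) (Fin 1 ⊕ Fin 2) ℝ).map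
      (MvPolynomial.C : ℝ →+* MvPolynomial (Fin 2) ℝ)).det) * (MvPolynomial.X 1 * MvPolynomial.pderiv 1 (∑ l, (MvPolynomial.X (0 : Fin 2) : MvPolynomial (Fin 2) ℝ) ^ (![0, 1, 3] : Fin 3 → ℕ)
      l • (S l).map (MvPolynomial.C : ℝ →+* MvPolynomial (Fin 2) ℝ) + (MvPolynomial.X (1 : Fin 2) : MvPolynomial (Fin 2) ℝ) • (Matrix.fromBlocks 1 0 0 0 : Matrix (Fin 1 ⊕ Fin 2) (Fin 1 ⊕ Fin
      2) ℝ).map (MvPolynomial.C : ℝ →+* MvPolynomial (Fin 2) ℝ)).det) + MvPolynomial.X 1 * MvPolynomial.pderiv 1 (MvPolynomial.X 1 * MvPolynomial.pderiv 1 (∑ l, (MvPolynomial.X (0 : Fin 2) :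
      MvPolynomial (Fin 2) ℝ) ^ (![0, 1, 3] : Fin 3 → ℕ) l • (S l).map (MvPolynomial.C : ℝ →+* MvPolynomial (Fin 2) ℝ) + (MvPolynomial.X (1 : Fin 2) : MvPolynomial (Fin 2) ℝ) •
      (Matrix.fromBlocks 1 0 0 0 : Matrix (Fin 1 ⊕ Fin 2) (Fin 1 ⊕ Fin 2) ℝ).map (MvPolynomial.C : ℝ →+* MvPolynomial (Fin 2) ℝ)).det) * (MvPolynomial.X 0 * MvPolynomial.pderiv 0 (∑ l,
      (MvPolynomial.X (0 : Fin 2) : MvPolynomial (Fin 2) ℝ) ^ (![0, 1, 3] : Fin 3 → ℕ) l • (S l).map (MvPolynomial.C : ℝ →+* MvPolynomial (Fin 2) ℝ) + (MvPolynomial.X (1 : Fin 2) :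
      MvPolynomial (Fin 2) ℝ) • (Matrix.fromBlocks 1 0 0 0 : Matrix (Fin 1 ⊕ Fin 2) (Fin 1 ⊕ Fin 2) ℝ).map (MvPolynomial.C : ℝ →+* MvPolynomial (Fin 2) ℝ)).det) ^ 2) = 0}.ncard := by
  have hfin := (osc_card_le_F4_top2 S hS).1
  subst hS
  have hF : (∑ l, (X : ℝ[X]) ^ (![0, 1, 3] : Fin 3 → ℕ) l • ((![Matrix.fromBlocks !![(-182 : ℝ)] !![101, -169] !![101; -169] !![20, -17; -17, 10],
        Matrix.fromBlocks !![(8 : ℝ)] !![-95, 53] !![-95; 53] !![-7, 12; 12, -63],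
        Matrix.fromBlocks !![(0 : ℝ)] !![0, 0] !![0; 0] !![-8, 0; 0, -8]] : Fin 3 → Matrix (Fin 1 ⊕ Fin 2) (Fin 1 ⊕ Fin 2) ℝ) l).map Polynomial.C).det =
      ((C ((-182) : ℝ) + C (8 : ℝ) * X) * (C (20 : ℝ) + C ((-7) : ℝ) * X + C ((-8) : ℝ) * X ^ 3) * (C (10 : ℝ) + C ((-63) : ℝ) * X + C ((-8) : ℝ) * X ^ 3)
        - (C ((-182) : ℝ) + C (8 : ℝ) * X) * (C ((-17) : ℝ) + C (12 : ℝ) * X) * (C ((-17) : ℝ) + C (12 : ℝ) * X)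
        - (C (101 : ℝ) + C ((-95) : ℝ) * X) * (C (101 : ℝ) + C ((-95) : ℝ) * X) * (C (10 : ℝ) + C ((-63) : ℝ) * X + C ((-8) : ℝ) * X ^ 3)
        + (C (101 : ℝ) + C ((-95) : ℝ) * X) * (C ((-17) : ℝ) + C (12 : ℝ) * X) * (C ((-169) : ℝ) + C (53 : ℝ) * X)
        + (C ((-169) : ℝ) + C (53 : ℝ) * X) * (C (101 : ℝ) + C ((-95) : ℝ) * X) * (C ((-17) : ℝ) + C (12 : ℝ) * X)
        - (C ((-169) : ℝ) + C (53 : ℝ) * X) * (C (20 : ℝ) + C ((-7) : ℝ) * X + C ((-8) : ℝ) * X ^ 3) * (C ((-169) : ℝ) + C (53 : ℝ) * X)) := by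
    rw [det_pencil_one_two]; simp [Fin.sum_univ_succ, -mul_eq_mul_right_iff, -mul_eq_mul_left_iff]; ring
  have hA : (∑ l, (X : ℝ[X]) ^ (![0, 1, 3] : Fin 3 → ℕ) l • (((![Matrix.fromBlocks !![(-182 : ℝ)] !![101, -169] !![101; -169] !![20, -17; -17, 10],
        Matrix.fromBlocks !![(8 : ℝ)] !![-95, 53] !![-95; 53] !![-7, 12; 12, -63],
        Matrix.fromBlocks !![(0 : ℝ)] !![0, 0] !![0; 0] !![-8, 0; 0, -8]] : Fin 3 → Matrix (Fin 1 ⊕ Fin 2) (Fin 1 ⊕ Fin 2) ℝ) l).toBlocks₂₂).map Polynomial.C).det =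
      ((C (20 : ℝ) + C ((-7) : ℝ) * X + C ((-8) : ℝ) * X ^ 3) * (C (10 : ℝ) + C ((-63) : ℝ) * X + C ((-8) : ℝ) * X ^ 3)
        - (C ((-17) : ℝ) + C (12 : ℝ) * X) * (C ((-17) : ℝ) + C (12 : ℝ) * X)) := by
    rw [det_lower_two]; simp [Fin.sum_univ_succ, -mul_eq_mul_right_iff, -mul_eq_mul_left_iff]; ring
  refine osc_rankOne_card_ge (![0, 1, 3] : Fin 3 → ℕ) _ _ _ hF hA hfin [((9141/8192 : ℝ), (18283/16384 : ℝ))]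
    (by simp) ?_
  intro w hw
  simp only [List.mem_cons, List.not_mem_nil, or_false] at hw
  subst hw
  exact F4t2_window_0 _ _ rfl rfl

end OsculationCensus

end Summit.ValiantsHypothesis.ValiantsHypothesis.Theorems.LacunarySymmetroidMatrixDescartes
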